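import Literature.Geometry.Kaehler.HolomorphicChainSliceChart
import Literature.Geometry.Kaehler.HolomorphicChainBoundary
import Literature.Geometry.Kaehler.HolomorphicChainRectifiableHolds
import Literature.Geometry.Kaehler.AnalyticSetSingularLocus
import Literature.Geometry.GeometricMeasureTheory.RectifiableGluing
import Literature.Geometry.GeometricMeasureTheory.CurrentsRestrict
import Literature.Geometry.GeometricMeasureTheory.RectifiableDataRestrict
import Literature.Geometry.GeometricMeasureTheory.CurrentsSlicing
import HarnessLib

/-!
# Sphere slices of a holomorphic chain are rectifiable currents

A brick of the proof of King's tangent cone theorem without the boundary rectifiability theorem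
(`Literature.Geometry.Kaehler.King1971_tangentCone`; [Harvey1977, Thm. 1.31], [Federer1969,
4.3.16]): for a holomorphic `(q+1)`-chain `T` on `Ω`, a closed ball `B̄(c, t₂) ⊆ Ω` and almost
every radius `ρ = √(-s) < t₂`, the boundary of the cut-down current `[reg|T| ∩ B(c,ρ), θ_T, ξ_T]`
is the rectifiable current of integration over the sphere slice `reg|T| ∩ S(c,ρ)` with a summable
integer multiplicity — Federer's "`⟨T, f, r+⟩ ∈ 𝓡_{m-1}` for almost all `r`" [Federer1969, 4.3.8]
for the integral cycle `[T]` [Harvey1977, Lemma 1.8], proved along Harvey's architecture for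
Lemma 1.8 one dimension down:

* `HolomorphicChain.exists_isRectifiableData_boundary_cut_eq` — **gluing on the regular part**:
  if every point of the slice carrier `M_s = reg|T| ∩ f⁻¹{s}` has the local slice data of
  `HolomorphicChain.ae_forall_exists_sliceData` (`HolomorphicChainSliceChart.lean`), then on every
  open `U' ≤ Ω` avoiding `Sing|T|` and containing `M_s` the boundary `∂[reg|T| ∩ {s<f}, θ_T, ξ_T]`
  IS a current of integration `[M_s, θ, ν]` with admissible data (the local data glue by the
  a.e. uniqueness of densities, `Current.exists_isRectifiableData_of_locally`; off `M_s` the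
  boundary vanishes near regular points by `HolomorphicChain.exists_nhds_boundary_apply_eq_zero`
  and trivially elsewhere);
* `HolomorphicChain.ae_mass_boundary_inter_ball_lt_top` — **almost every sphere slice has finite
  mass**: `𝐌(∂[reg|T| ∩ B(c,√(-s))]) < ∞` on the ball `B(c,t₂)` for a.e. level `s ∈ (-t₂², 0)` of
  `f = -‖· - c‖²` (the cycle `[T]|B(c,t₂)` has finite mass, so the slicing inequality
  `∫ 𝐌⟨T,f,s+⟩ ds ≤ C ∫ ‖Df‖ d‖T‖` applies [Federer1969, 4.2.1]);
* `HolomorphicChain.ae_exists_sphereSliceData` — **the sphere slices are rectifiable currents**: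
  for a.e. `s ∈ (-t₂², 0)`, `ρ = √(-s)`, there are admissible data `(reg|T| ∩ S(c,ρ), θ, ν)` on the
  whole space with `∫ |θ| d𝓗^{2q+1} < ∞` and
  `∂[reg|T| ∩ B(c,ρ), θ_T, ξ_T] = [reg|T| ∩ S(c,ρ), θ, ν]` on EVERY open set `U`: glue on
  `B(c,t₂) ∖ Sing|T|`, bound `∫ |θ|` by the finite slice mass (mass formula), extend the data
  across `Sing|T|` (summable density), and remove the exceptional set `Sing|T|` of
  `𝓗^{2q+1}`-measure zero (`HolomorphicChain.euclideanHausdorffMeasure_image_singularLocus_eq_zero`)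
  by the support theorem `Current.add_boundary_eq_zero_of_isLocallyRectifiable`
  [Federer1969, 4.1.20].

Theorems only; no definitions, no named facts.

## References

* H. Federer, *Geometric Measure Theory*, Springer 1969, 4.3.8, 4.2.1, 4.1.20, 4.1.28 [Federer1969].
* R. Harvey, *Holomorphic chains and their boundaries*, PSPUM XXX.1 (1977), Lemma 1.8 (p. 320),
  §1.10 [Harvey1977].
-/

open scoped Manifold Topology ContDiff ENNReal NNReal
open Set Filter MeasureTheory Metric Function TopologicalSpace

/-! ### Plumbing: restriction to smaller open sets, data with summable multiplicity -/

namespace Literature.Geometry.GeometricMeasureTheory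

-- Nested operator-norm instances on (duals of) `V [⋀^Fin m]→L[ℝ] ℝ`.
set_option maxSynthPendingDepth 2

section Plumbing

variable {E : Type*} [NormedAddCommGroup E] [NormedSpace ℝ E] {Ω' Ω : Opens E} {m : ℕ}

/-- **`𝐌(X|Ω') ≤ 𝐌(X)`** for the restriction `X|Ω' = X ∘ ι` of a current to a smaller open set.
[cite: Federer1969, 4.1.7] -/
theorem Current.mass_comp_monoCLM_le (hle : Ω' ≤ Ω) (X : Current Ω m) :
    Current.mass (X.comp (TestFunction.monoCLM ℝ) : Current Ω' m) ≤ X.mass := by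
  refine iSup₂_le fun ψ hψ => ?_
  rw [ContinuousLinearMap.comp_apply]
  exact X.ofReal_apply_le_mass fun x => by rw [TestForm.monoCLM_apply_of_le hle]; exact hψ x

end Plumbing

section Summable

variable {V : Type*} [NormedAddCommGroup V] [InnerProductSpace ℝ V] [FiniteDimensional ℝ V]
  [MeasurableSpace V] [BorelSpace V] {Ω Ω' : Opens V} {m : ℕ}

/-- **Admissible data with summable multiplicity are admissible on every open set containing the
carrier**: if `(W, θ, ξ)` are admissible on `Ω` and `∫_W |θ| d𝓗^m < ∞`, the density `θ ξ` is
globally `𝓗^m ⌞ W`-summable, hence locally summable on any `Ω' ⊇ W`. [cite: Federer1969, 4.1.28 (4), (5)] -/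
theorem IsRectifiableData.of_lintegral_lt_top {W : Set V} {θ : V → ℤ} {ξ : V → Fin m → V}
    (h : IsRectifiableData Ω m W θ ξ)
    (hfin : ∫⁻ x in W, ‖(θ x : ℝ)‖ₑ ∂(μHE[m] : Measure V) < ⊤) (hW : W ⊆ (Ω' : Set V)) :
    IsRectifiableData Ω' m W θ ξ := by
  obtain ⟨hWm, hWΩ, hrect, hint, hae⟩ := h
  refine ⟨hWm, hW, hrect, ?_, hae⟩
  have hmeas : AEStronglyMeasurable (fun x => (θ x : ℝ) • frameVector (ξ x))
      ((μHE[m] : Measure V).restrict W) := by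
    have h1 := hint.aestronglyMeasurable
    rwa [Measure.restrict_restrict Ω.isOpen.measurableSet, inter_eq_right.2 hWΩ] at h1
  have hI : Integrable (fun x => (θ x : ℝ) • frameVector (ξ x)) ((μHE[m] : Measure V).restrict W) := by
    refine ⟨hmeas, ?_⟩
    show ∫⁻ x, ‖(θ x : ℝ) • frameVector (ξ x)‖ₑ ∂((μHE[m] : Measure V).restrict W) < ⊤
    calc ∫⁻ x, ‖(θ x : ℝ) • frameVector (ξ x)‖ₑ ∂((μHE[m] : Measure V).restrict W)
        = ∫⁻ x, ‖(θ x : ℝ)‖ₑ ∂((μHE[m] : Measure V).restrict W) := by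
          refine lintegral_congr_ae ?_
          filter_upwards [hae] with x hx
          rw [enorm_smul, ← ofReal_norm (frameVector (ξ x)), norm_frameVector_eq_one hx.1,
            ENNReal.ofReal_one, mul_one]
      _ < ⊤ := hfin
  exact hI.locallyIntegrable.locallyIntegrableOn _

end Summable

end Literature.Geometry.GeometricMeasureTheory

namespace Literature.Geometry.Kaehler

namespace HolomorphicChain

open Literature.Geometry.GeometricMeasureTheory

-- Nested operator-norm instances on `Covector V m`, as in `Currents.lean`.
set_option maxSynthPendingDepth 2

variable {V : Type*} [NormedAddCommGroup V] [InnerProductSpace ℂ V] [FiniteDimensional ℂ V]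
  [MeasurableSpace V] [BorelSpace V] {Ω : Opens V}

/-! ### The multiplicity is summable over compacts -/

/-- **`∫_{reg|T| ∩ K} |θ_T| d𝓗^{2p} < ∞` for compact `K ⊆ Ω`**: the density `θ_T ξ_T` of `[T]` is
locally summable on `Ω` (`Harvey1977_isRectifiableData_toCurrent_holds`, by Lelong's theorem) and
`‖θ_T ξ_T‖ = |θ_T|` a.e. (orthonormal frames). [cite: Harvey1977, Lemma 1.3 and Cor. 1.4] -/
theorem lintegral_enorm_density_inter_lt_top {p : ℕ} (T : HolomorphicChain 𝓘(ℂ, V) Ω p)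
    {K : Set V} (hK : IsCompact K) (hKΩ : K ⊆ (Ω : Set V)) :
    ∫⁻ x in T.carrier ∩ K, ‖(T.density x : ℝ)‖ₑ ∂(μHE[2 * p] : Measure V) < ⊤ := by
  letI : InnerProductSpace ℝ V := InnerProductSpace.complexToReal
  have hT := Harvey1977_isRectifiableData_toCurrent_holds V Ω p T
  have hint := hT.2.2.2.1.integrableOn_compact_subset hKΩ hK
  rw [inter_comm, ← Measure.restrict_restrict hK.isClosed.measurableSet]
  calc ∫⁻ x in K, ‖(T.density x : ℝ)‖ₑ ∂((μHE[2 * p] : Measure V).restrict T.carrier)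
      = ∫⁻ x in K, ‖(T.density x : ℝ) • frameVector (T.orientationFrame x)‖ₑ
          ∂((μHE[2 * p] : Measure V).restrict T.carrier) := by
        refine lintegral_congr_ae ?_
        filter_upwards [ae_restrict_of_ae hT.2.2.2.2] with x hx
        rw [enorm_smul, ← ofReal_norm (frameVector (T.orientationFrame x)),
          norm_frameVector_eq_one hx.1, ENNReal.ofReal_one, mul_one]
    _ < ⊤ := hint.2

/-! ### Gluing the local slices on the regular part -/

/-- **The boundary of a cut-down chain is a current of integration over the slice, on the regular
part.** Let `T` be a holomorphic `(q+1)`-chain on `Ω`, `f` smooth, `s` a level such that every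
point of `M_s = reg|T| ∩ f⁻¹{s}` has the local slice data of `ae_forall_exists_sliceData`, and
`U' ≤ Ω` an open set containing `M_s` and avoiding `Sing|T|`. Then
`∂[reg|T| ∩ {s<f}, θ_T, ξ_T] = [M_s, θ, ν]` on `U'` for some admissible data `(M_s, θ, ν)` on `U'`:
the local data glue (`Current.exists_isRectifiableData_of_locally`, uniqueness of densities),
and off `M_s` the boundary vanishes locally — off `|T|` trivially, near a regular point `x` with
`f x < s` because `dφ` lives off `{s<f}`, and with `s < f x` because there it is `d[T](φ) = 0`
(`exists_nhds_boundary_apply_eq_zero`). [cite: Federer1969, 4.3.8; Harvey1977, Lemma 1.8 (proof)] -/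
theorem exists_isRectifiableData_boundary_cut_eq {q : ℕ} (T : HolomorphicChain 𝓘(ℂ, V) Ω (q + 1))
    {f : V → ℝ} (hf : ContDiff ℝ ∞ f) {s : ℝ} {U' : Opens V} (hU'Ω : U' ≤ Ω)
    (hU's : Disjoint (U' : Set V) (((↑) : Ω → V) '' singularLocus 𝓘(ℂ, V) T.support))
    (hMU' : T.carrier ∩ f ⁻¹' {s} ⊆ (U' : Set V))
    (hloc : letI : InnerProductSpace ℝ V := InnerProductSpace.complexToReal
      ∀ x ∈ T.carrier, f x = s →
        ∃ O : Set V, IsOpen O ∧ x ∈ O ∧ ∃ (θ : V → ℤ) (ν : V → Fin (2 * q + 1) → V),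
          IsRectifiableData Ω (2 * q + 1) (T.carrier ∩ f ⁻¹' {s} ∩ O) θ ν ∧
          ∀ U : Opens V, U ≤ Ω → ∀ φ : TestForm U (2 * q + 1), tsupport ⇑φ ⊆ O →
            (currentOfIntegration (T.carrier ∩ {y | s < f y}) T.density
                (T.orientationFrame : V → Fin (2 * q + 1 + 1) → V) :
                  Current U (2 * q + 1 + 1)).boundary φ =
              currentOfIntegration (T.carrier ∩ f ⁻¹' {s} ∩ O) θ ν φ) :
    letI : InnerProductSpace ℝ V := InnerProductSpace.complexToReal
    ∃ (θ : V → ℤ) (ν : V → Fin (2 * q + 1) → V),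
      IsRectifiableData U' (2 * q + 1) (T.carrier ∩ f ⁻¹' {s}) θ ν ∧
      Current.boundary (currentOfIntegration (T.carrier ∩ {y | s < f y}) T.density
          (T.orientationFrame : V → Fin (2 * q + 1 + 1) → V) : Current U' (2 * q + 1 + 1)) =
        currentOfIntegration (T.carrier ∩ f ⁻¹' {s}) θ ν := by
  letI iV : InnerProductSpace ℝ V := InnerProductSpace.complexToReal
  haveI : LocallyCompactSpace Ω := Ω.isOpen.locallyCompactSpace
  classical
  have hMm : MeasurableSet (T.carrier ∩ f ⁻¹' {s}) :=
    T.measurableSet_carrier.inter (hf.continuous.measurable (measurableSet_singleton s))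
  refine (Current.boundary (currentOfIntegration (T.carrier ∩ {y | s < f y}) T.density
    (T.orientationFrame : V → Fin (2 * q + 1 + 1) → V) :
      Current U' (2 * q + 1 + 1))).exists_isRectifiableData_of_locally hMm hMU' (fun x hx => ?_)
    (fun x hxU hxM => ?_)
  · -- local data at the points of `M`
    obtain ⟨O, hOo, hxO, θ, ν, hdΩ, hident⟩ := hloc x hx.1 hx.2
    refine ⟨O, hOo, hxO, θ, ν, ?_, hident U' hU'Ω⟩
    have h1 := hdΩ.inter_of_le hU'Ω
    rwa [inter_eq_left.2 (inter_subset_left.trans hMU')] at h1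
  · -- off `M` the boundary vanishes locally
    have hxΩ : x ∈ (Ω : Set V) := hU'Ω hxU
    have hxs : x ∉ ((↑) : Ω → V) '' singularLocus 𝓘(ℂ, V) T.support :=
      fun h => Set.disjoint_left.1 hU's hxU h
    by_cases hxZ : x ∈ ((↑) : Ω → V) '' T.support
    · -- `x` is a regular point of `|T|`: `x ∈ reg|T|`, `f x ≠ s`
      have hxc : x ∈ T.carrier := by
        obtain ⟨y, hy, rfl⟩ := hxZ
        refine ⟨y, ⟨hy, ?_⟩, rfl⟩
        by_contra hreg
        exact hxs ⟨y, ⟨hy, fun h => hreg h.2⟩, rfl⟩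
      have hfx : f x ≠ s := fun h => hxM ⟨hxc, h⟩
      rcases lt_or_gt_of_ne hfx with hlt | hgt
      · -- `f x < s`: `dφ` lives off `{s < f}`
        refine ⟨{y | f y < s}, isOpen_lt hf.continuous continuous_const, hlt,
          Set.disjoint_left.2 fun y hy hyM => (show f y < s from hy).ne hyM.2, fun φ hφ => ?_⟩
        rw [T.boundary_currentOfIntegration_inter_apply hU'Ω]
        refine setIntegral_eq_zero_of_forall_eq_zero fun y hy => ?_
        have hyφ : y ∉ tsupport ⇑φ := fun h =>
          lt_asymm (show f y < s from hφ h) (show s < f y from hy.2)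
        simp [TestForm.extDeriv_eq_zero_of_notMem_tsupport φ hyφ]
      · -- `s < f x`: near `x` the boundary is `d[T] = 0`
        obtain ⟨Ux, hUx, hUx0⟩ := T.exists_nhds_boundary_apply_eq_zero hxc
        refine ⟨interior Ux ∩ {y | s < f y},
          isOpen_interior.inter (isOpen_lt continuous_const hf.continuous),
          ⟨mem_interior_iff_mem_nhds.2 hUx, hgt⟩,
          Set.disjoint_left.2 fun y hy hyM => (show s < f y from hy.2).ne' hyM.2, fun φ hφ => ?_⟩
        rw [T.boundary_currentOfIntegration_inter_apply hU'Ω]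
        have h1 : ∫ y in T.carrier ∩ {y | s < f y}, (T.density y : ℝ) * (extDeriv ⇑φ y)
              (T.orientationFrame y) ∂(μHE[2 * q + 1 + 1] : Measure V) =
            ∫ y in T.carrier, (T.density y : ℝ) * (extDeriv ⇑φ y) (T.orientationFrame y)
              ∂(μHE[2 * q + 1 + 1] : Measure V) := by
          refine (setIntegral_eq_of_subset_of_forall_sdiff_eq_zero T.measurableSet_carrier
            inter_subset_left ?_).symm
          rintro y ⟨hyc, hyE⟩
          have hyφ : y ∉ tsupport ⇑φ := fun h => hyE ⟨hyc, (hφ h).2⟩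
          simp [TestForm.extDeriv_eq_zero_of_notMem_tsupport φ hyφ]
        rw [h1]
        set ψ : TestForm Ω (2 * q + 1) := TestFunction.monoCLM ℝ φ with hψ
        have hψφ : ⇑ψ = ⇑φ := TestForm.monoCLM_apply_of_le hU'Ω φ
        have h2 := T.boundary_apply_eq_setIntegral ψ
        rw [hψφ] at h2
        rw [← h2]
        exact hUx0 ψ (by rw [hψφ]; exact hφ.trans (inter_subset_left.trans interior_subset))
    · -- off `|T|`
      refine ⟨((↑) : Ω → V) '' (T.support)ᶜ,
        Ω.isOpen.isOpenMap_subtype_val _ T.isClosed_support.isOpen_compl,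
        ⟨⟨x, hxΩ⟩, fun h => hxZ ⟨_, h, rfl⟩, rfl⟩, ?_, fun φ hφ => ?_⟩
      · refine Set.disjoint_left.2 ?_
        rintro _ ⟨y, hy, rfl⟩ hyM
        obtain ⟨y', hy', hyy⟩ := hyM.1
        obtain rfl := Subtype.ext hyy
        exact hy hy'.1
      · rw [T.boundary_currentOfIntegration_inter_apply hU'Ω]
        refine setIntegral_eq_zero_of_forall_eq_zero fun y hy => ?_
        have hyφ : y ∉ tsupport ⇑φ := fun h => by
          obtain ⟨w, hw, hwy⟩ := hφ h
          obtain ⟨w', hw', hwy'⟩ := hy.1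
          obtain rfl := Subtype.ext (hwy'.trans hwy.symm)
          exact hw hw'.1
        simp [TestForm.extDeriv_eq_zero_of_notMem_tsupport φ hyφ]

/-! ### The slicing function `-‖· - c‖²` -/

omit [InnerProductSpace ℂ V] [FiniteDimensional ℂ V] [MeasurableSpace V] [BorelSpace V] in
/-- The superlevel set `{s < -‖x - c‖²}` is the ball `B(c, √(-s))`. [cite: Federer1969, 4.3.16] -/
theorem setOf_lt_neg_norm_sub_sq_eq_ball (c : V) (s : ℝ) :
    {x : V | s < -‖x - c‖ ^ 2} = ball c (Real.sqrt (-s)) := by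
  ext x
  rw [mem_setOf_eq, mem_ball, dist_eq_norm, Real.lt_sqrt (norm_nonneg _)]
  constructor <;> intro h <;> linarith

omit [InnerProductSpace ℂ V] [FiniteDimensional ℂ V] [MeasurableSpace V] [BorelSpace V] in
/-- The level set `{-‖x - c‖² = s}` (`s ≤ 0`) is the sphere `S(c, √(-s))`. [cite: Federer1969, 4.3.16] -/
theorem preimage_neg_norm_sub_sq_singleton (c : V) {s : ℝ} (hs : s ≤ 0) :
    (fun x : V => -‖x - c‖ ^ 2) ⁻¹' {s} = sphere c (Real.sqrt (-s)) := by
  ext x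
  simp only [mem_preimage, mem_singleton_iff, mem_sphere, dist_eq_norm]
  constructor
  · intro h
    rw [← h, neg_neg, Real.sqrt_sq (norm_nonneg _)]
  · intro h
    rw [h, Real.sq_sqrt (by linarith), neg_neg]

omit [FiniteDimensional ℂ V] [MeasurableSpace V] [BorelSpace V] in
/-- `‖D(-‖· - c‖²)(x)‖ = 2 ‖x - c‖`. [cite: Federer1969, 4.3.16] -/
theorem norm_fderiv_neg_norm_sub_sq (c x : V) :
    letI : InnerProductSpace ℝ V := InnerProductSpace.complexToReal
    ‖fderiv ℝ (fun y : V => -‖y - c‖ ^ 2) x‖ = 2 * ‖x - c‖ := by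
  letI : InnerProductSpace ℝ V := InnerProductSpace.complexToReal
  have h1 : HasFDerivAt (fun y : V => ‖y - c‖ ^ 2) (2 • innerSL ℝ (x - c)) x := by
    have h := (hasStrictFDerivAt_norm_sq (x - c)).hasFDerivAt.comp x
      ((hasFDerivAt_id x).sub_const c)
    rw [ContinuousLinearMap.comp_id] at h
    exact h
  have h2 : HasFDerivAt (fun y : V => -‖y - c‖ ^ 2) (-(2 • innerSL ℝ (x - c))) x := h1.neg
  rw [h2.fderiv, norm_neg, two_nsmul, ← two_smul ℝ, norm_smul, innerSL_apply_norm, Real.norm_two]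

/-! ### Almost every sphere slice has finite mass -/

/-- **Almost every sphere slice of a holomorphic chain has finite mass.** For a holomorphic
`(q+1)`-chain `T` on `Ω` and a closed ball `B̄(c,t₂) ⊆ Ω`: for almost every level `s ∈ (-t₂², 0)`
of `f = -‖· - c‖²`, the boundary of the cut-down current `[reg|T| ∩ B(c,√(-s)), θ_T, ξ_T]`, read
on the ball `B(c,t₂)`, has finite mass. The current `X = [T]|B(c,t₂)` is a cycle
(`Harvey1977_boundary_toCurrent_eq_zero_holds`) of finite mass (`∫_{reg|T| ∩ B̄(c,t₂)} |θ_T| < ∞`),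
`‖Df‖ ≤ 2t₂` where `‖X‖` lives, so `∫_{(a,b)} 𝐌⟨X, f, s+⟩ ds < ∞` through the measurable majorants
`liminfₙ sliceWindow` [Federer1969, 4.2.1]; and `⟨X, f, s+⟩ = -∂(X ⌞ {s<f}) = -∂[reg|T| ∩ B(c,√(-s))]`.
[cite: Federer1969, 4.2.1, 4.3.8] -/
theorem ae_mass_boundary_inter_ball_lt_top {q : ℕ} (T : HolomorphicChain 𝓘(ℂ, V) Ω (q + 1))
    {c : V} {t₂ : ℝ} (ht₂ : 0 < t₂) (hB : closedBall c t₂ ⊆ (Ω : Set V)) :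
    letI : InnerProductSpace ℝ V := InnerProductSpace.complexToReal
    ∀ᵐ s : ℝ, s ∈ Ioo (-t₂ ^ 2) 0 →
      (Current.boundary (currentOfIntegration (T.carrier ∩ ball c (Real.sqrt (-s))) T.density
        (T.orientationFrame : V → Fin (2 * q + 1 + 1) → V) :
          Current (⟨ball c t₂, isOpen_ball⟩ : Opens V) (2 * q + 1 + 1))).mass < ⊤ := by
  letI iV : InnerProductSpace ℝ V := InnerProductSpace.complexToReal
  haveI : FiniteDimensional ℝ V := FiniteDimensional.complexToReal V
  set U₀ : Opens V := ⟨ball c t₂, isOpen_ball⟩ with hU₀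
  have hU₀Ω : U₀ ≤ Ω := fun x hx => hB (ball_subset_closedBall hx)
  set f : V → ℝ := fun y => -‖y - c‖ ^ 2 with hfdef
  have hfs : ContDiff ℝ ∞ f := ((contDiff_norm_sq ℂ).comp (contDiff_id.sub contDiff_const)).neg
  have hTΩ := Harvey1977_isRectifiableData_toCurrent_holds V Ω (q + 1) T
  have hd₀ : IsRectifiableData U₀ (2 * (q + 1)) (T.carrier ∩ (U₀ : Set V)) T.density
      T.orientationFrame := hTΩ.inter_of_le hU₀Ω
  set X : Current U₀ (2 * q + 1 + 1) := currentOfIntegration (T.carrier ∩ (U₀ : Set V)) T.density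
    (T.orientationFrame : V → Fin (2 * q + 1 + 1) → V) with hXdef
  have hX : X.IsRepresentable := hd₀.isRepresentable
  -- `X = [T]|B(c,t₂)` is a cycle
  have hXeq : X = (currentOfIntegration T.carrier T.density
      (T.orientationFrame : V → Fin (2 * q + 1 + 1) → V) : Current U₀ (2 * q + 1 + 1)) :=
    currentOfIntegration_inter_eq_of_le hTΩ.1 hU₀Ω hTΩ.2.2.2.1
  have h0X : X.boundary = 0 := by
    rw [hXeq]
    exact currentOfIntegration_boundary_eq_zero_of_le hU₀Ω hTΩ.2.2.2.1
      (Harvey1977_boundary_toCurrent_eq_zero_holds V Ω q T)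
  have hdX : X.boundary.IsRepresentable := by
    rw [h0X]; exact Current.isRepresentable_zero
  -- finite mass
  have hXmass : X.mass ≠ ⊤ := by
    have h1 : X.mass = ∫⁻ x in T.carrier ∩ (U₀ : Set V), ‖(T.density x : ℝ)‖ₑ
        ∂(μHE[2 * q + 1 + 1] : Measure V) := hd₀.mass_eq
    rw [h1]
    refine ne_top_of_le_ne_top
      (T.lintegral_enorm_density_inter_lt_top (isCompact_closedBall c t₂) hB).ne ?_
    exact lintegral_mono_set (inter_subset_inter_right _ ball_subset_closedBall)
  -- `‖Df‖ ≤ 2 t₂` where `‖X‖` lives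
  have hvar : ∀ᵐ x ∂X.variation, x ∈ (U₀ : Set V) := by
    have h := X.variation_compl
    rw [measure_eq_zero_iff_ae_notMem] at h
    filter_upwards [h] with x hx using not_notMem.1 hx
  have hIfin : ∀ a b : ℝ, ENNReal.ofReal (sliceConst (2 * q + 1)) *
      ∫⁻ x in f ⁻¹' Icc a (b + 1), ‖fderiv ℝ f x‖ₑ ∂X.variation ≠ ⊤ := by
    intro a b
    refine ENNReal.mul_ne_top ENNReal.ofReal_ne_top (ne_top_of_le_ne_top
      (ENNReal.mul_ne_top (ENNReal.ofReal_ne_top (r := 2 * t₂)) hXmass) ?_)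
    calc ∫⁻ x in f ⁻¹' Icc a (b + 1), ‖fderiv ℝ f x‖ₑ ∂X.variation
        ≤ ∫⁻ x, ‖fderiv ℝ f x‖ₑ ∂X.variation := setLIntegral_le_lintegral _ _
      _ ≤ ∫⁻ _, ENNReal.ofReal (2 * t₂) ∂X.variation := by
          refine lintegral_mono_ae (hvar.mono fun x hx => ?_)
          rw [← ofReal_norm, hfdef, norm_fderiv_neg_norm_sub_sq]
          have hx' : ‖x - c‖ < t₂ := mem_ball_iff_norm.1 hx
          exact ENNReal.ofReal_le_ofReal (by linarith)
      _ = ENNReal.ofReal (2 * t₂) * X.variation univ := lintegral_const _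
      _ ≤ ENNReal.ofReal (2 * t₂) * X.mass := by gcongr; exact X.variation_le_mass _
  -- the measurable majorant of the slice masses is a.e. finite on `(a, 1)`, `a = -(t₂² + 1)`
  set a : ℝ := -(t₂ ^ 2 + 1) with ha
  have hmeas : Measurable fun r => liminf (fun n => sliceWindow X f n r) atTop :=
    Measurable.liminf fun n => measurable_sliceWindow hX hfs n
  have hfin : ∀ᵐ r ∂(volume : Measure ℝ), r ∈ Ioo a 1 →
      liminf (fun n => sliceWindow X f n r) atTop < ⊤ := by
    have hI := hX.lintegral_liminf_sliceWindow_le hfs a 1 one_pos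
    have := ae_lt_top' hmeas.aemeasurable (ne_top_of_le_ne_top (hIfin a 1) hI)
    exact (ae_restrict_iff' measurableSet_Ioo).1 this
  filter_upwards [hfin] with s hs hst
  have hsI : s ∈ Ioo a 1 := ⟨by rw [ha]; linarith [hst.1], by linarith [hst.2]⟩
  have hslice : (hX.slice hdX hfs.continuous s).mass < ⊤ :=
    (hX.mass_slice_le_liminf hdX hfs s).trans_lt (hs hsI)
  -- the slice is `-∂(X ⌞ {s < f})`, and `X ⌞ {s < f} = [reg|T| ∩ B(c, √(-s))]`
  have hEm : MeasurableSet {y : V | s < f y} := measurableSet_lt_of_continuous hfs.continuous s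
  have hsl : hX.slice hdX hfs.continuous s = -(hX.restrictSet {y | s < f y} hEm).boundary := by
    rw [Current.IsRepresentable.slice, hdX.restrictSet_of_eq_zero h0X, zero_sub]
  have hρt : Real.sqrt (-s) ≤ t₂ :=
    calc Real.sqrt (-s) ≤ Real.sqrt (t₂ ^ 2) := Real.sqrt_le_sqrt (by linarith [hst.1])
      _ = t₂ := Real.sqrt_sq ht₂.le
  have hset : T.carrier ∩ (U₀ : Set V) ∩ {y | s < f y} = T.carrier ∩ ball c (Real.sqrt (-s)) := by
    rw [inter_assoc, show {y : V | s < f y} = ball c (Real.sqrt (-s)) from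
      setOf_lt_neg_norm_sub_sq_eq_ball c s,
      inter_eq_right.2 (show ball c (Real.sqrt (-s)) ⊆ (U₀ : Set V) from ball_subset_ball hρt)]
  have hres : hX.restrictSet {y | s < f y} hEm =
      (currentOfIntegration (T.carrier ∩ ball c (Real.sqrt (-s))) T.density
        (T.orientationFrame : V → Fin (2 * q + 1 + 1) → V) : Current U₀ (2 * q + 1 + 1)) := by
    have h1 := hd₀.restrictSet_eq hEm
    rw [hset] at h1
    exact h1
  rw [← hres, ← Current.mass_neg, ← hsl]
  exact hslice

/-! ### The sphere slices are rectifiable currents -/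

/-- **Sphere slices of a holomorphic chain are rectifiable currents with summable multiplicity.**
For a holomorphic `(q+1)`-chain `T` on `Ω` and a closed ball `B̄(c,t₂) ⊆ Ω`: for almost every
`s ∈ (-t₂², 0)`, with `ρ = √(-s)`, there are admissible rectifiable data
`(reg|T| ∩ S(c,ρ), θ, ν)` on the whole space with `∫_{reg|T| ∩ S(c,ρ)} |θ| d𝓗^{2q+1} < ∞` such
that `∂[reg|T| ∩ B(c,ρ), θ_T, ξ_T] = [reg|T| ∩ S(c,ρ), θ, ν]` as currents on EVERY open set `U`.
Proof (Harvey's architecture for Lemma 1.8, one dimension down): the local slices of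
`ae_forall_exists_sliceData` glue on `U' = B(c,t₂) ∖ Sing|T|`
(`exists_isRectifiableData_boundary_cut_eq`); the glued multiplicity is summable by the mass
formula and `ae_mass_boundary_inter_ball_lt_top`, so the data are admissible on the whole space;
`-[slice] + ∂[cut]` is then a sum of a locally rectifiable current and the boundary of one,
supported in `Sing|T|`, a set of `𝓗^{2q+1}`-measure zero
(`euclideanHausdorffMeasure_image_singularLocus_eq_zero`), hence zero by the support theorem
(`Current.add_boundary_eq_zero_of_isLocallyRectifiable`); restriction to `U` commutes with `∂`.
[cite: Federer1969, 4.3.8, 4.1.20; Harvey1977, Lemma 1.8 (proof, p. 320)] -/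
theorem ae_exists_sphereSliceData {q : ℕ} (T : HolomorphicChain 𝓘(ℂ, V) Ω (q + 1)) {c : V}
    {t₂ : ℝ} (ht₂ : 0 < t₂) (hB : closedBall c t₂ ⊆ (Ω : Set V)) :
    letI : InnerProductSpace ℝ V := InnerProductSpace.complexToReal
    ∀ᵐ s : ℝ, s ∈ Ioo (-t₂ ^ 2) 0 →
      ∃ (θ : V → ℤ) (ν : V → Fin (2 * q + 1) → V),
        IsRectifiableData (⊤ : Opens V) (2 * q + 1) (T.carrier ∩ sphere c (Real.sqrt (-s))) θ ν ∧
        ∫⁻ x in T.carrier ∩ sphere c (Real.sqrt (-s)), ‖(θ x : ℝ)‖ₑ ∂(μHE[2 * q + 1] : Measure V)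
          < ⊤ ∧
        ∀ U : Opens V,
          Current.boundary (currentOfIntegration (T.carrier ∩ ball c (Real.sqrt (-s))) T.density
              (T.orientationFrame : V → Fin (2 * q + 1 + 1) → V) : Current U (2 * q + 1 + 1)) =
            currentOfIntegration (T.carrier ∩ sphere c (Real.sqrt (-s))) θ ν := by
  letI iV : InnerProductSpace ℝ V := InnerProductSpace.complexToReal
  haveI : FiniteDimensional ℝ V := FiniteDimensional.complexToReal V
  haveI : LocallyCompactSpace Ω := Ω.isOpen.locallyCompactSpace
  classical
  set f : V → ℝ := fun y => -‖y - c‖ ^ 2 with hfdef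
  have hfs : ContDiff ℝ ∞ f := ((contDiff_norm_sq ℂ).comp (contDiff_id.sub contDiff_const)).neg
  have hTΩ := Harvey1977_isRectifiableData_toCurrent_holds V Ω (q + 1) T
  filter_upwards [T.ae_forall_exists_sliceData hfs, T.ae_mass_boundary_inter_ball_lt_top ht₂ hB]
    with s hloc hmass hs
  replace hmass := hmass hs
  -- the radius `ρ = √(-s) < t₂`; `{s < f} = B(c,ρ)`, `f⁻¹{s} = S(c,ρ)`
  set ρ : ℝ := Real.sqrt (-s) with hρ
  have hρt : ρ < t₂ := by rw [hρ, Real.sqrt_lt' ht₂]; linarith [hs.1]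
  have hE : {y : V | s < f y} = ball c ρ := setOf_lt_neg_norm_sub_sq_eq_ball c s
  have hMs : f ⁻¹' {s} = sphere c ρ := preimage_neg_norm_sub_sq_singleton c hs.2.le
  have hEm : MeasurableSet {y : V | s < f y} := measurableSet_lt_of_continuous hfs.continuous s
  have hballΩ : closedBall c ρ ⊆ (Ω : Set V) := (closedBall_subset_closedBall hρt.le).trans hB
  set M : Set V := T.carrier ∩ sphere c ρ with hM
  have hMf : T.carrier ∩ f ⁻¹' {s} = M := by rw [hMs]
  have hMB : M ⊆ closedBall c ρ := inter_subset_right.trans sphere_subset_closedBall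
  -- the open sets `U₀ = B(c,t₂)` and `U' = B(c,t₂) ∖ Sing|T|`
  set SingV : Set V := ((↑) : Ω → V) '' singularLocus 𝓘(ℂ, V) T.support with hSingV
  have hSo : IsOpen (((↑) : Ω → V) '' (singularLocus 𝓘(ℂ, V) T.support)ᶜ) :=
    Ω.isOpen.isOpenMap_subtype_val _ (isClosed_singularLocus T.isClosed_support).isOpen_compl
  set U₀ : Opens V := ⟨ball c t₂, isOpen_ball⟩ with hU₀
  set U' : Opens V := ⟨ball c t₂ ∩ ((↑) : Ω → V) '' (singularLocus 𝓘(ℂ, V) T.support)ᶜ,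
    isOpen_ball.inter hSo⟩ with hU'
  have hU'U₀ : U' ≤ U₀ := fun x hx => hx.1
  have hU₀Ω : U₀ ≤ Ω := fun x hx => hB (ball_subset_closedBall hx)
  have hU'Ω : U' ≤ Ω := hU'U₀.trans hU₀Ω
  have hle' : U' ≤ (⊤ : Opens V) := le_top
  have hU's : Disjoint (U' : Set V) SingV := by
    refine Set.disjoint_left.2 ?_
    rintro x ⟨-, y, hy, rfl⟩ ⟨y', hy', hyy⟩
    obtain rfl := Subtype.ext hyy
    exact hy hy'
  have hcarU : ∀ x ∈ T.carrier, x ∈ closedBall c ρ → x ∈ (U' : Set V) := by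
    rintro x ⟨y, hy, rfl⟩ hxb
    exact ⟨closedBall_subset_ball hρt hxb, y, fun h => h.2 hy, rfl⟩
  have hMU' : T.carrier ∩ f ⁻¹' {s} ⊆ (U' : Set V) := by
    rw [hMf]
    exact fun x hx => hcarU x hx.1 (hMB hx)
  -- (1) glue on `U'`
  obtain ⟨θ₁, ν₁, hd₁, hglue⟩ :=
    T.exists_isRectifiableData_boundary_cut_eq hfs hU'Ω hU's hMU' hloc
  rw [hMf] at hd₁
  rw [hMf, hE] at hglue
  -- (2) the glued multiplicity is summable: `∫_M |θ₁| = 𝐌(∂[cut]|U') ≤ 𝐌(∂[cut]|U₀) < ∞`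
  have hintΩ : LocallyIntegrableOn
      (fun x => (T.density x : ℝ) • frameVector (T.orientationFrame x : Fin (2 * q + 1 + 1) → V))
      (Ω : Set V) ((μHE[2 * q + 1 + 1] : Measure V).restrict (T.carrier ∩ ball c ρ)) := by
    intro x hx
    obtain ⟨u, hu, hu'⟩ :=
      (T.locallyIntegrableOn_of_lelong Lelong1957_hausdorffMeasure_inter_lt_top_holds) x hx
    exact ⟨u, hu, hu'.mono_measure (Measure.restrict_mono inter_subset_left le_rfl)⟩
  have hSU' : (currentOfIntegration (T.carrier ∩ ball c ρ) T.density
        (T.orientationFrame : V → Fin (2 * q + 1 + 1) → V) : Current U' (2 * q + 1 + 1)) =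
      (currentOfIntegration (T.carrier ∩ ball c ρ) T.density
        (T.orientationFrame : V → Fin (2 * q + 1 + 1) → V) : Current U₀ (2 * q + 1 + 1)).comp
        (TestFunction.monoCLM ℝ) :=
    currentOfIntegration_eq_comp_monoCLM hU'U₀ (hintΩ.mono_set (show (U₀ : Set V) ⊆ Ω from hU₀Ω))
  have hfin : ∫⁻ x in M, ‖(θ₁ x : ℝ)‖ₑ ∂(μHE[2 * q + 1] : Measure V) < ⊤ := by
    rw [← hd₁.mass_eq, ← hglue, hSU', Current.boundary_comp_monoCLM hU'U₀]
    exact (Current.mass_comp_monoCLM_le hU'U₀ _).trans_lt hmass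
  -- (3) the data are admissible on the whole space
  have hdT : IsRectifiableData (⊤ : Opens V) (2 * q + 1) M θ₁ ν₁ :=
    hd₁.of_lintegral_lt_top hfin (subset_univ _)
  have hcut : IsRectifiableData (⊤ : Opens V) (2 * q + 1 + 1) (T.carrier ∩ ball c ρ) T.density
      (T.orientationFrame : V → Fin (2 * q + 1 + 1) → V) := by
    have h1 : IsRectifiableData Ω (2 * q + 1 + 1) (T.carrier ∩ ball c ρ) T.density
        (T.orientationFrame : V → Fin (2 * q + 1 + 1) → V) := hTΩ.inter measurableSet_ball
    refine h1.of_lintegral_lt_top (lt_of_le_of_lt (lintegral_mono_set ?_)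
      (T.lintegral_enorm_density_inter_lt_top (isCompact_closedBall c t₂) hB)) (subset_univ _)
    exact inter_subset_inter_right _
      (ball_subset_closedBall.trans (closedBall_subset_closedBall hρt.le))
  -- (4) the support theorem on the whole space: `-[M, θ₁, ν₁] + ∂[cut] = 0`
  set ST : Current (⊤ : Opens V) (2 * q + 1 + 1) := currentOfIntegration (T.carrier ∩ ball c ρ)
    T.density (T.orientationFrame : V → Fin (2 * q + 1 + 1) → V) with hST
  set R : Current (⊤ : Opens V) (2 * q + 1) := currentOfIntegration M (fun x => -θ₁ x) ν₁ with hR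
  have hRloc : R.IsLocallyRectifiable := ⟨_, _, _, hdT.neg, rfl⟩
  have hSloc : ST.IsLocallyRectifiable := ⟨_, _, _, hcut, rfl⟩
  have hsupp : (R + ST.boundary).support ⊆ SingV := by
    intro x hx
    by_contra hxs
    by_cases hxb : x ∈ closedBall c ρ
    · -- near a point of `U'`, read the currents on `U'`, where they cancel
      have hxU' : x ∈ (U' : Set V) :=
        ⟨closedBall_subset_ball hρt hxb, ⟨x, hballΩ hxb⟩, fun h => hxs ⟨_, h, rfl⟩, rfl⟩
      refine Current.notMem_support_of_forall_apply_eq_zero _ U'.isOpen (fun φ hφ => ?_) hxU' hx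
      set ψ : TestForm U' (2 * q + 1) := ⟨⇑φ, φ.contDiff, φ.hasCompactSupport, hφ⟩ with hψ
      have hψφ : (TestFunction.monoCLM ℝ ψ : TestForm (⊤ : Opens V) (2 * q + 1)) = φ := by
        apply TestFunction.ext
        intro y
        rw [TestForm.monoCLM_apply_of_le hle']
        rfl
      rw [← hψφ]
      show R (TestFunction.monoCLM ℝ ψ) + ST.boundary (TestFunction.monoCLM ℝ ψ) = 0
      have h1 : R (TestFunction.monoCLM ℝ ψ) =
          (currentOfIntegration M (fun x => -θ₁ x) ν₁ : Current U' (2 * q + 1)) ψ := by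
        rw [hR, currentOfIntegration_eq_comp_monoCLM hle' hdT.neg.2.2.2.1]
        rfl
      have h2 : ST.boundary (TestFunction.monoCLM ℝ ψ) =
          Current.boundary (currentOfIntegration (T.carrier ∩ ball c ρ) T.density
            (T.orientationFrame : V → Fin (2 * q + 1 + 1) → V) : Current U' (2 * q + 1 + 1)) ψ := by
        rw [currentOfIntegration_eq_comp_monoCLM hle' hcut.2.2.2.1, Current.boundary_comp_monoCLM hle']
        rfl
      rw [h1, h2, hglue, currentOfIntegration_neg]
      simp
    · -- off `B̄(c,ρ)` both currents vanish
      refine Current.notMem_support_of_forall_apply_eq_zero _ isClosed_closedBall.isOpen_compl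
        (fun φ hφ => ?_) hxb hx
      show R φ + ST.boundary φ = 0
      have h1 : R φ = 0 := by
        rw [hR, currentOfIntegration_apply hdT.neg.2.2.2.1]
        refine setIntegral_eq_zero_of_forall_eq_zero fun y hy => ?_
        have hyφ : y ∉ tsupport ⇑φ := fun h => hφ h (hMB hy)
        simp [image_eq_zero_of_notMem_tsupport hyφ]
      have h2 : ST.boundary φ = 0 := by
        rw [Current.boundary_apply, hST, currentOfIntegration_apply hcut.2.2.2.1]
        refine setIntegral_eq_zero_of_forall_eq_zero fun y hy => ?_
        have hyφ : y ∉ tsupport ⇑φ := fun h => hφ h (ball_subset_closedBall hy.2)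
        rw [TestForm.extDerivCLM_apply]
        simp [TestForm.extDeriv_eq_zero_of_notMem_tsupport φ hyφ]
      rw [h1, h2, add_zero]
  have hnull : (μHE[2 * q + 1] : Measure V) (R + ST.boundary).support = 0 :=
    measure_mono_null hsupp T.euclideanHausdorffMeasure_image_singularLocus_eq_zero
  have hzero : R + ST.boundary = 0 := Current.add_boundary_eq_zero_of_isLocallyRectifiable hRloc hSloc hnull
  have hST' : ST.boundary = currentOfIntegration M θ₁ ν₁ := by
    rw [hR, currentOfIntegration_neg, neg_add_eq_zero] at hzero
    exact hzero.symm
  -- (5) read on an arbitrary open set `U`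
  refine ⟨θ₁, ν₁, hdT, hfin, fun U => ?_⟩
  have hleU : U ≤ (⊤ : Opens V) := le_top
  rw [currentOfIntegration_eq_comp_monoCLM hleU hcut.2.2.2.1, Current.boundary_comp_monoCLM hleU,
    currentOfIntegration_eq_comp_monoCLM hleU hdT.2.2.2.1]
  exact congrArg (fun X : Current (⊤ : Opens V) (2 * q + 1) => X.comp (TestFunction.monoCLM ℝ)) hST'

end HolomorphicChain

end Literature.Geometry.Kaehler
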